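import Summits.CriticalPhenomena.PercolationContinuityZ3.Theorems.PercNearOneGluingNoHeavyLowerTailSahiHereditaryMeetAbsorption
import Summits.CriticalPhenomena.PercolationContinuityZ3.Theorems.PercNearOneGluingNoHeavyLowerTailSahiC3CubeAnyIndex
import Literature.Combinatorics.Sahi2008.Indicators
import HarnessLib

/-!
# `NoHeavyLowerTail` (stmt-CriticalPhenomena-4575) — all orders on `≤ 4` coins for fourwise meet-absorbing families (computational companion)

Support file, seat `prim-l12-p5` (gen 4), `--supports stmt-CriticalPhenomena-4575`, COMPUTATIONAL (inherits the `native_decide` certificate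
`SahiC3Cube.checkCube_four` through `SahiC3Cube.sahiC3_of_card_le_four`).  No definitions, no named facts, no sorries.

* `sahiPositive_bernoulliWeight_three_of_card_le_four` — order-`3` Sahi positivity (function form) of every product weight `bernoulliWeight p`
  on `2^ι`, `|ι| ≤ 4`: the kernel-checked `C_3` for increasing events on `{0,1}^k`, `k ≤ 4`, plus the layer cake
  (`Literature…sahiPositive_iff_indicators`), exactly as in `kahnConjecture_iff_sahiPositive`.
* `bernoulliWeight_sahiE_ind_nonneg_of_fourwise_of_card_le_four` — hence, by hierarchy lifting
  (`SahiHereditaryMeetAbsorption.sahiE_nonneg_of_sahiPositive_three_of_fourwise`): on `≤ 4` coins, increasing events `A_0,…,A_{m−1}` such that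
  among any FOUR one contains the intersection of the other three have `E_m(1_{A_0},…,1_{A_{m−1}}) ≥ 0` for EVERY `m` — unconditionally
  (previously all orders were settled in the tree on `≤ 3` coins, `SahiCubeAllOrders.sahiPositive_set_of_card_le_three`).
-/

namespace Summit.CriticalPhenomena.PercolationContinuityZ3.Theorems

namespace SahiHereditaryMeetAbsorption

open Finset Function Literature.Combinatorics.Sahi2008
open Literature.Probability.Percolation.DecisionTree (ind ind_of_mem ind_of_not_mem ind_nonneg)

/-- Order-`3` Sahi positivity of every product weight on at most FOUR coins, from the tree's kernel-checked `C_3` on `{0,1}^k`, `k ≤ 4`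
(`SahiC3Cube.sahiC3_of_card_le_four`) and the layer cake (`sahiPositive_iff_indicators`). [this file] -/
theorem sahiPositive_bernoulliWeight_three_of_card_le_four {ι : Type*} [Fintype ι] (hι : Fintype.card ι ≤ 4)
    (p : ι → unitInterval) : SahiPositive (bernoulliWeight p) 3 := by
  classical
  rw [sahiPositive_iff_indicators]
  intro U hU
  have hind : (fun i => setInd (U i)) =
      ![ind (U 0 : Set (Set ι)), ind (U 1 : Set (Set ι)), ind (U 2 : Set (Set ι))] := by
    funext i ω
    fin_cases i <;> simp [setInd_apply, ind]
  rw [hind, sahiE_three_ind]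
  exact SahiC3Cube.sahiC3_of_card_le_four hι p (fun a b hab ha => hU 0 hab ha) (fun a b hab ha => hU 1 hab ha)
    (fun a b hab ha => hU 2 hab ha)

/-- **Unconditional on `≤ 4` coins, every order**: for a product measure on `2^ι`, `|ι| ≤ 4`, and increasing events `A_0,…,A_{m−1}` such that
among any FOUR one contains the intersection of the other three, `E_m(1_{A_0},…,1_{A_{m−1}}) ≥ 0` for every `m` (hierarchy lifting from the
kernel-checked `C_3`). [this file] -/
theorem bernoulliWeight_sahiE_ind_nonneg_of_fourwise_of_card_le_four {ι : Type*} [Fintype ι] (hι : Fintype.card ι ≤ 4)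
    (p : ι → unitInterval) (m : ℕ) (A : Fin m → Set (Set ι)) (hA : ∀ i, IsUpperSet (A i))
    (h4 : ∀ S : Finset (Fin m), S.card = 4 → ∃ q ∈ S, ∀ ω, (∀ i ∈ S.erase q, ω ∈ A i) → ω ∈ A q) :
    0 ≤ sahiE (bernoulliWeight p) m (fun i => ind (A i)) := by
  refine sahiE_nonneg_of_sahiPositive_three_of_fourwise (isFKGMeasure_bernoulliWeight p).nonneg
    (isFKGMeasure_bernoulliWeight p).sum_eq_one (sahiPositive_bernoulliWeight_three_of_card_le_four hι p) m _
    (fun i ω => ?_) (fun i => monotone_ind_of_isUpperSet (hA i)) fun S hS => exists_absorber_ind A S (h4 S hS)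
  by_cases h : ω ∈ A i
  · exact Or.inr (ind_of_mem h)
  · exact Or.inl (ind_of_not_mem h)

end SahiHereditaryMeetAbsorption

end Summit.CriticalPhenomena.PercolationContinuityZ3.Theorems
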